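import Summits.CriticalPhenomena.PercolationContinuityZ3.Theorems.PercNearOneGluingNoHeavyLowerTailPatternSunflower
import HarnessLib

/-!
# `NoHeavyLowerTail` (stmt-CriticalPhenomena-4575) — certificate machine add-on: SUNFLOWER (strong Harris–Kleitman)
# rows as GROUPS of product rows, and a group-sum soundness theorem for the checker

Support file (prover prim-gen-kcluster gen 5, k-cluster line; `--supports stmt-CriticalPhenomena-4575`).  Two bookkeeping
definitions (`cellsPat`, `shkRows3`), no named facts, no sorries.

The reflective checker `CertCheck.check` (blobmono, parts 1–7) proves `Σ_a w_a m_a (L − U_a) ≤ 0` from PRODUCT ROWS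
`E₁E₂ ≤ E₃E₄`, each valid on its own (`CertCheck.sound`, hypothesis `hrows` row by row).  A strong-Harris–Kleitman row
(`PatternSunflower.patternSunflower_three`) has the shape `c₁c₂ + c₁c₃ + c₂c₃ ≤ μ(A)μ(B)` with TWO negative products, and
no single-product weakening of it cuts the pseudo-laws of the `(U₁)₃` search (memo KCLUSTER-gen5.md §3).  Rather than
changing the checker's data, this file
* proves the checker sound under the WEAKER hypothesis that the row inequalities hold IN SUM
  (`CertCheck.sound_of_rowSum`, `CertCheck.sound_of_buckets_rowSum`; the algebra of `check` is untouched), so that a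
  sunflower row can be fed as a GROUP of ordinary rows sharing multiplier and weight — `shkRows3 A B C₁ C₂ C₃ m w =
  [⟨C₁, C₂ ++ C₃, A, B, m, w⟩, ⟨C₂, C₃, [], [], m, w⟩]` — whose summed inequality is exactly the sunflower row
  (`rowSum_shkRows3_le`); singleton groups of valid product rows and concatenations of groups keep the summed form
  (`rowSum_le_of_forall`, `rowSum_append_le`);
* links pattern tests to cell lists: `cellsPat φ = consPatterns.filter φ`, `linEval_cellsPat` (its `linEval` at the
  cell law is `μ(PatEvent v φ)`), `patEvent_not3` (the complement cell test), and
* `shkRows3_rowSum_le` — for pattern tests with the decidable side conditions of `patternSunflower_three`, the group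
  `shkRows3 (cellsPat φA) (cellsPat φB) (cellsPat φ₁) (cellsPat φ₂) (cellsPat φ₃) m w` satisfies the summed row
  inequality at the cell law of every weighted graph and placement — i.e. SHK rows are admissible checker input.
[cite: Gladkov2024StrongFKG, Thm. 2.1 / Cor. 4.2]
-/

noncomputable section

namespace Summit.CriticalPhenomena.PercolationContinuityZ3.Theorems

open MeasureTheory Set Literature.Probability.Percolation
open Literature.Probability.LatticeModels (prodBernoulli)
open scoped Classical BigOperators
open PatternCells CertCheck CertCells PatternSunflower

namespace CertCheck

variable (x : ℕ → ℝ)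

/-- **Soundness of the checker under the summed row hypothesis.**  If `check L U rows al = true`, `x ≥ 0`, and
the rows hold IN SUM at `x` (`Σ_r w_r m_r E₁E₂ ≤ Σ_r w_r m_r E₃E₄`), then `Σ_a w_a m_a (L − U_a) ≤ 0`. [folklore] -/
theorem sound_of_rowSum (hx : ∀ i, 0 ≤ x i) (L : List ℕ) (U : ℕ → List ℕ) (rows : List Row) (al : List ATerm)
    (hR : (rows.map fun r => (r.wt : ℝ) * evalM x r.mult * (linEval x r.e1 * linEval x r.e2)).sum ≤
      (rows.map fun r => (r.wt : ℝ) * evalM x r.mult * (linEval x r.e3 * linEval x r.e4)).sum)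
    (h : check L U rows al = true) :
    (al.map fun a => (a.wt : ℝ) * evalM x a.mult * (linEval x L - linEval x (U a.ref))).sum ≤ 0 := by
  have hdom := evalT_le_of_dominated x hx _ _ h
  rw [evalT_normalize, evalT_normalize, evalT_plusTerms, evalT_minusTerms] at hdom
  have key : (al.map fun a => (a.wt : ℝ) * evalM x a.mult * linEval x L).sum -
      (al.map fun a => (a.wt : ℝ) * evalM x a.mult * linEval x (U a.ref)).sum ≤ 0 := by linarith
  rw [sum_map_sub] at key
  have heq : (al.map fun a => (a.wt : ℝ) * evalM x a.mult * linEval x L -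
      (a.wt : ℝ) * evalM x a.mult * linEval x (U a.ref)) =
      (al.map fun a => (a.wt : ℝ) * evalM x a.mult * (linEval x L - linEval x (U a.ref))) := by
    refine List.map_congr_left fun a _ => ?_
    ring
  rw [heq] at key
  exact key

/-- **Bucketed form** of `sound_of_rowSum`. [folklore] -/
theorem sound_of_buckets_rowSum (hx : ∀ i, 0 ≤ x i) (L : List ℕ) (U : ℕ → List ℕ) (rows : List Row)
    (al : List ATerm) {nb : ℕ} (hnb : 0 < nb)
    (hR : (rows.map fun r => (r.wt : ℝ) * evalM x r.mult * (linEval x r.e1 * linEval x r.e2)).sum ≤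
      (rows.map fun r => (r.wt : ℝ) * evalM x r.mult * (linEval x r.e3 * linEval x r.e4)).sum)
    (h : ∀ b < nb, checkB nb b L U rows al = true) :
    (al.map fun a => (a.wt : ℝ) * evalM x a.mult * (linEval x L - linEval x (U a.ref))).sum ≤ 0 := by
  have hdom : evalT x (plusTerms L rows al) ≤ evalT x (minusTerms U rows al) := by
    rw [evalT_eq_sum_buckets x hnb (plusTerms L rows al), evalT_eq_sum_buckets x hnb (minusTerms U rows al)]
    apply List.sum_le_sum
    intro b hb
    have hc := h b (List.mem_range.1 hb)
    have := evalT_le_of_dominated x hx _ _ hc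
    rwa [evalT_normalize, evalT_normalize] at this
  rw [evalT_plusTerms, evalT_minusTerms] at hdom
  have key : (al.map fun a => (a.wt : ℝ) * evalM x a.mult * linEval x L).sum -
      (al.map fun a => (a.wt : ℝ) * evalM x a.mult * linEval x (U a.ref)).sum ≤ 0 := by linarith
  rw [sum_map_sub] at key
  have heq : (al.map fun a => (a.wt : ℝ) * evalM x a.mult * linEval x L -
      (a.wt : ℝ) * evalM x a.mult * linEval x (U a.ref)) =
      (al.map fun a => (a.wt : ℝ) * evalM x a.mult * (linEval x L - linEval x (U a.ref))) := by
    refine List.map_congr_left fun a _ => ?_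
    ring
  rw [heq] at key
  exact key

/-- Rows valid one by one are valid in sum (singleton groups). [folklore] -/
theorem rowSum_le_of_forall (rows : List Row)
    (hrows : ∀ r ∈ rows, linEval x r.e1 * linEval x r.e2 ≤ linEval x r.e3 * linEval x r.e4)
    (hx : ∀ i, 0 ≤ x i) :
    (rows.map fun r => (r.wt : ℝ) * evalM x r.mult * (linEval x r.e1 * linEval x r.e2)).sum ≤
      (rows.map fun r => (r.wt : ℝ) * evalM x r.mult * (linEval x r.e3 * linEval x r.e4)).sum := by
  apply List.sum_le_sum
  intro r hr
  exact mul_le_mul_of_nonneg_left (hrows r hr) (mul_nonneg (Nat.cast_nonneg _) (evalM_nonneg x hx _))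

/-- Groups valid in sum concatenate. [folklore] -/
theorem rowSum_append_le (rows rows' : List Row)
    (h : (rows.map fun r => (r.wt : ℝ) * evalM x r.mult * (linEval x r.e1 * linEval x r.e2)).sum ≤
      (rows.map fun r => (r.wt : ℝ) * evalM x r.mult * (linEval x r.e3 * linEval x r.e4)).sum)
    (h' : (rows'.map fun r => (r.wt : ℝ) * evalM x r.mult * (linEval x r.e1 * linEval x r.e2)).sum ≤
      (rows'.map fun r => (r.wt : ℝ) * evalM x r.mult * (linEval x r.e3 * linEval x r.e4)).sum) :
    ((rows ++ rows').map fun r => (r.wt : ℝ) * evalM x r.mult * (linEval x r.e1 * linEval x r.e2)).sum ≤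
      ((rows ++ rows').map fun r => (r.wt : ℝ) * evalM x r.mult * (linEval x r.e3 * linEval x r.e4)).sum := by
  rw [List.map_append, List.map_append, List.sum_append, List.sum_append]
  exact add_le_add h h'

/-- `linEval` of a concatenated cell list. [folklore] -/
theorem linEval_append (e e' : List ℕ) : linEval x (e ++ e') = linEval x e + linEval x e' := by
  unfold linEval
  rw [List.map_append, List.sum_append]

/-- **A three-petal sunflower row as a group of two product rows** sharing multiplier `m` and weight `w`:
`⟨C₁, C₂ ++ C₃, A, B⟩` and `⟨C₂, C₃, [], []⟩`; in sum they read `w·m·(c₁(c₂+c₃) + c₂c₃) ≤ w·m·(μA·μB)`. [this file] -/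
def shkRows3 (A B C₁ C₂ C₃ mult : List ℕ) (wt : ℕ) : List Row :=
  [⟨C₁, C₂ ++ C₃, A, B, mult, wt⟩, ⟨C₂, C₃, [], [], mult, wt⟩]

/-- The summed inequality of a `shkRows3` group follows from the sunflower inequality of its cell sums. [this file] -/
theorem rowSum_shkRows3_le (hx : ∀ i, 0 ≤ x i) (A B C₁ C₂ C₃ mult : List ℕ) (wt : ℕ)
    (hshk : linEval x C₁ * linEval x C₂ + linEval x C₁ * linEval x C₃ + linEval x C₂ * linEval x C₃ ≤
      linEval x A * linEval x B) :
    ((shkRows3 A B C₁ C₂ C₃ mult wt).map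
        fun r => (r.wt : ℝ) * evalM x r.mult * (linEval x r.e1 * linEval x r.e2)).sum ≤
      ((shkRows3 A B C₁ C₂ C₃ mult wt).map
        fun r => (r.wt : ℝ) * evalM x r.mult * (linEval x r.e3 * linEval x r.e4)).sum := by
  unfold shkRows3
  simp only [List.map_cons, List.map_nil, List.sum_cons, List.sum_nil, add_zero]
  rw [linEval_append, show linEval x ([] : List ℕ) = 0 by unfold linEval; simp]
  have hw : 0 ≤ (wt : ℝ) * evalM x mult := mul_nonneg (Nat.cast_nonneg _) (evalM_nonneg x hx _)
  nlinarith [mul_le_mul_of_nonneg_left hshk hw]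

end CertCheck

namespace PatternSunflower

variable {n : ℕ}

/-- The cells of a pattern test: the consistent patterns passing it. [this file] -/
def cellsPat (φ : ℕ → Bool) : List ℕ := consPatterns.filter φ

/-- **At the cell law, the `linEval` of `cellsPat φ` is `μ(PatEvent v φ)`.** [this file] -/
theorem linEval_cellsPat (μ : Measure (BondConfig (Fin n))) [IsFiniteMeasure μ] (v : Fin 5 → Fin n)
    (φ : ℕ → Bool) :
    linEval (fun m => μ.real (Cell v m)) (cellsPat φ) = μ.real (PatEvent v φ) := by
  rw [measureReal_patEvent, sum_cells_eq_listSum]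
  rfl

/-- The complement test of a sunflower with three petals is the pattern event of the negated disjunction. [this file] -/
theorem patEvent_not3 (v : Fin 5 → Fin n) (φA φ₁ φ₂ φ₃ : ℕ → Bool) :
    PatEvent v (fun m => !(φA m || φ₁ m || φ₂ m || φ₃ m)) =
      (PatEvent v φA ∪ (PatEvent v φ₁ ∪ PatEvent v φ₂ ∪ PatEvent v φ₃))ᶜ := by
  ext ω
  obtain ⟨m, hm, hcell⟩ := exists_mem_cell v ω
  simp only [Set.mem_compl_iff, Set.mem_union, mem_patEvent_iff v _ hm hcell, Bool.not_eq_true',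
    Bool.or_eq_false_iff, not_or]
  constructor
  · rintro ⟨⟨⟨hA, h1⟩, h2⟩, h3⟩
    exact ⟨by simp [hA], ⟨⟨by simp [h1], by simp [h2]⟩, by simp [h3]⟩⟩
  · rintro ⟨hA, ⟨⟨h1, h2⟩, h3⟩⟩
    refine ⟨⟨⟨?_, ?_⟩, ?_⟩, ?_⟩ <;> simpa using (by assumption : ¬_ = true)

/-- **SHK rows are admissible checker input.**  For pattern tests with the (decidable) side conditions of
`patternSunflower_three`, at the cell law `x m = μ(Cell v m)` of any weighted graph and placement `v`, the group
`shkRows3 (cellsPat φA) (cellsPat φB) (cellsPat φ₁) (cellsPat φ₂) (cellsPat φ₃) mult wt`, `φB = ¬(φA ∨ φ₁ ∨ φ₂ ∨ φ₃)`,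
satisfies the summed row inequality of `CertCheck.sound_of_rowSum`. [cite: Gladkov2024StrongFKG, Cor. 4.2] -/
theorem shkRows3_rowSum_le (w : Sym2 (Fin n) → unitInterval) (v : Fin 5 → Fin n) (φA φ₁ φ₂ φ₃ : ℕ → Bool)
    (hA : MonoPat φA = true)
    (h1 : MonoPat (fun m => φA m || φ₁ m) = true) (h2 : MonoPat (fun m => φA m || φ₂ m) = true)
    (h3 : MonoPat (fun m => φA m || φ₃ m) = true)
    (d12 : DisjPat φ₁ φ₂ = true) (d13 : DisjPat φ₁ φ₃ = true) (d23 : DisjPat φ₂ φ₃ = true)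
    (dA1 : DisjPat φA φ₁ = true) (dA2 : DisjPat φA φ₂ = true) (dA3 : DisjPat φA φ₃ = true)
    (mult : List ℕ) (wt : ℕ) :
    let x : ℕ → ℝ := fun m => (prodBernoulli w).real (Cell v m)
    let rows := CertCheck.shkRows3 (cellsPat φA) (cellsPat fun m => !(φA m || φ₁ m || φ₂ m || φ₃ m))
      (cellsPat φ₁) (cellsPat φ₂) (cellsPat φ₃) mult wt
    (rows.map fun r => (r.wt : ℝ) * evalM x r.mult * (linEval x r.e1 * linEval x r.e2)).sum ≤
      (rows.map fun r => (r.wt : ℝ) * evalM x r.mult * (linEval x r.e3 * linEval x r.e4)).sum := by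
  intro x rows
  have hx : ∀ i, 0 ≤ x i := fun i => measureReal_nonneg
  apply CertCheck.rowSum_shkRows3_le x hx
  rw [linEval_cellsPat, linEval_cellsPat, linEval_cellsPat, linEval_cellsPat, linEval_cellsPat, patEvent_not3]
  exact patternSunflower_three w v φA φ₁ φ₂ φ₃ hA h1 h2 h3 d12 d13 d23 dA1 dA2 dA3

end PatternSunflower

end Summit.CriticalPhenomena.PercolationContinuityZ3.Theorems

end
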